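import Literature.NumberTheory.GelbartRogawski1991.LocalDoubledUnitarySplittingDataCM
import Literature.NumberTheory.GelbartRogawski1991.LocalDoubledUnitaryDeltaTransport
import Literature.NumberTheory.GelbartRogawski1991.DoubledUnitarySiegelPlaceComponents
import Literature.NumberTheory.GelbartRogawski1991.DoubledWeilRepresentationArchLagrangian
import HarnessLib

/-!
# The per-place package of the doubled Weil representation at the CM dual-pair datum

[GelbartRogawski1991, §3.1 Prop. 3.1.1] by doubling, finite places, CM specialisation: for a CM field `L`, the
doubled datum `T^𝔻 = T ⊕ (−T)` of `DoubledUnitaryGlobalSplittingData` and a Hecke character `χ` of `L` with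
`χ|_{𝕀_{L⁺}} = ε_{L/L⁺}` (`IsSplittingChar L 1 χ`), the local splitting data `localSplittingDatumCM`
(`LocalDoubledUnitarySplittingDataCM`: Kudla's splitting [Kudla1994, Thm. 3.1] of the doubled unitary group at every
finite place `v` of `L⁺`, split or not, for the local components of `χ⁻¹`) assemble into a
`FinLocalFamily χ 𝔪` (`nonempty_finLocalFamily`): Lagrangian `ℓ_Δ = deltaLagrangian` (carried onto `ℓ_Y` by `δ`,
`map_deltaLoc_deltaLagrangian` from `LocalDoubledUnitaryDeltaTransport`), the local parabolic normalisation from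
`localSplittingDatumCM_parabolic` through the place-component bridges of `DoubledUnitarySiegelPlaceComponents`
(`isSiegelDelta_locToAdelic_iff`, `isUnit_detDelta_locToAdelic_iff`, `chiDet_locToAdelic_eq_prod_dite`,
`modDelta_locToAdelic`), and the unramified clause for almost all `v` (`eventually_isGoodPlace_localComponent_inv`,
`localSplittingDatumCM_unramified`).  With `DoubledWeilRepresentationFiniteHalf` this yields the finite half of the
doubled Weil representation; nothing is asserted here.
-/

set_option autoImplicit false

noncomputable section

open scoped Classical
open scoped Matrix Kronecker TensorProduct
open NumberField IsDedekindDomain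
open Literature.RepresentationTheory.HeisenbergGroup
open Literature.NumberTheory.Automorphic
open Literature.NumberTheory.Weil1964
open Literature.RepresentationTheory.HarrisKudlaSweet1996
open Literature.NumberTheory.GaloisRepresentations

namespace Literature.NumberTheory.GelbartRogawski1991.GRConstruction

open UnitaryDualPair

variable (L : Type) [Field L] [NumberField L] [IsCMField L]

variable {N M n : ℕ} (e : Fin N × Fin M ≃ Fin n)
  (dV : Fin N → L) (hdV : ∀ i, IsCMField.complexConj L (dV i) = dV i) (hdV0 : ∀ i, dV i ≠ 0)
  (dW : Fin M → L) (hdW : ∀ i, IsCMField.complexConj L (dW i) = dW i) (hdW0 : ∀ i, dW i ≠ 0)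

section S1finLocal

open Literature.NumberTheory.GelbartRogawski1991.UnitaryDualPair.LocalSplitting hiding IsSiegelDelta chiDet deltaBlock
  detDelta e₂ gramD gramD_isSymm gramS hermD isUnit_det_gramD
open MeasureTheory

/-- `T` (the undoubled rational Gram matrix) is symmetric.
[cite: GelbartRogawski1991, §3.1 Prop. 3.1.1 p. 455 L1–2] -/
theorem gramR_isSymm : (gramR L e dV hdV dW hdW).IsSymm := by
  show (Matrix.reindex e e _).IsSymm
  exact (UnitaryGroup.isSymm_kronecker (realDiagonal_isSymm L dV hdV) (realDiagonal_isSymm L dW hdW)).submatrix _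

/-- `J^𝔻 = T^𝔻 ⊗ L` in the spelling of the local package (`rfl`: the two `gramD`s have the same body).
[cite: GelbartRogawski1991, §3.1 Prop. 3.1.1 p. 455 L1–2] -/
theorem hermD_eq_map_gramD :
    hermD L e dV hdV dW hdW =
      (Literature.NumberTheory.GelbartRogawski1991.UnitaryDualPair.LocalSplitting.gramD (Fp L) n (gramR L e dV hdV dW hdW)).map
        (algebraMap (Fp L) L) := rfl

/-- **`δ_v ℓ_Δ = ℓ_Y`** at every finite place (`map_transportSp_deltaDiag_deltaLagrangian` at `A := δ ⊗ 1`).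
[cite: GelbartRogawski1991, §3.1 Prop. 3.1.1 p. 455 L1–2] -/
theorem map_deltaLoc_deltaLagrangian (v : HeightOneSpectrum (𝓞 (Fp L))) :
    (deltaLagrangian (Fp L) v n).map (toLin (Fp L) v (deltaLoc L e dV hdV hdV0 dW hdW hdW0 v)) = lagrangianY (Fp L) (n + n) v :=
  map_transportSp_deltaDiag_deltaLagrangian (Fp L) v n (T₀ := gramR L e dV hdV dW hdW) (isUnit_det_gramR₀ L e dV hdV hdV0 dW hdW hdW0)
    (isUnit_det_gramDLoc L e dV hdV hdV0 dW hdW hdW0 v)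
    (SymplecticMatrix.mapHom (algebraMap (Fp L) (v.adicCompletion (Fp L))) (deltaD L)) (by
      rw [SymplecticMatrix.coe_mapHom]
      change (Matrix.reindex _ _ (deltaDiagMatrix (Fp L) (Fin n))).map _ = _
      rw [Matrix.reindex_apply, Matrix.reindex_apply, ← Matrix.submatrix_map, deltaDiagMatrix_map])

section Family

variable (χ : HeckeCharacter L) (hχ : IsSplittingChar L 1 χ) (𝔪 : ∀ v, PlaceMeasure L v)

/-- **the CM datum at `v`** (`localSplittingDatumCM`: the split datum at a split place, the non-split one otherwise), in the
shape `LocalDatumAt` (instances from `𝔪 v`, Lagrangian `ℓ_Δ = deltaLagrangian`).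
[cite: GelbartRogawski1991, §3.1 Prop. 3.1.1 p. 455 L1–2] -/
def cmDatumAt (v : HeightOneSpectrum (𝓞 (Fp L))) :
    LocalDatumAt L e dV hdV hdV0 dW hdW hdW0 v (𝔪 v) (deltaLagrangian (Fp L) v n)
      (deltaLagrangian_orthogonal (Fp L) v n (gramR L e dV hdV dW hdW) (isUnit_det_gramR₀ L e dV hdV hdV0 dW hdW hdW0)) := by
  letI := (𝔪 v).mS; haveI := (𝔪 v).isBorel; haveI := (𝔪 v).isHaar
  exact localSplittingDatumCM L v (𝔪 v).μ n (T₀ := gramR L e dV hdV dW hdW) (gramR_isSymm L e dV hdV dW hdW)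
    (isUnit_det_gramR₀ L e dV hdV hdV0 dW hdW hdW0) (JD := hermD L e dV hdV dW hdW) (hermD_eq_map_gramD L e dV hdV dW hdW) χ hχ

include hχ in
/-- **S1fin-local**: the family of local data at the doubled CM datum — Lagrangian `ℓ_Δ`, datum
`localSplittingDatumCM`, parabolic normalisation (`localSplittingDatumCM_parabolic` + the bridges
`isSiegelDelta_locToAdelic_iff`, `chiDet_locToAdelic_eq_prod_dite`, `modDelta_locToAdelic`), unramified clause
(`eventually_isGoodPlace_localComponent_inv` + `localSplittingDatumCM_unramified`).
[cite: GelbartRogawski1991, §3.1 Prop. 3.1.1 p. 455 L1–2] -/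
theorem nonempty_finLocalFamily : Nonempty (FinLocalFamily L e dV hdV hdV0 dW hdW hdW0 χ 𝔪) := by
  classical
  refine ⟨{ ℓ := fun v => deltaLagrangian (Fp L) v n
            hℓ := fun v => deltaLagrangian_orthogonal (Fp L) v n (gramR L e dV hdV dW hdW)
              (isUnit_det_gramR₀ L e dV hdV hdV0 dW hdW hdW0)
            𝓓 := fun v => cmDatumAt L e dV hdV hdV0 dW hdW hdW0 χ hχ 𝔪 v
            parabolicNormalised := fun v => ?_
            unramified := ?_ }⟩
  · letI := (𝔪 v).mS; haveI := (𝔪 v).isBorel; haveI := (𝔪 v).isHaar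
    intro p hS hu Φ
    have hloc := (isUnit_detDelta_locToAdelic_iff L e dV hdV dW hdW v p).1 hu
    have hp : Literature.NumberTheory.GelbartRogawski1991.UnitaryDualPair.LocalSplitting.IsSiegelDelta (Fp L) L
        (IsCMField.complexConj L) (complexConj_imagUnit L) (imagUnit_ne_zero L) (imagUnit_mul_self L) v n
        (gramR_isSymm L e dV hdV dW hdW) (hermD_eq_map_gramD L e dV hdV dW hdW) p :=
      (isSiegelDelta_iff (Fp L) L (IsCMField.complexConj L) (complexConj_imagUnit L) (imagUnit_ne_zero L) (imagUnit_mul_self L)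
        v n (gramR_isSymm L e dV hdV dW hdW) (hermD_eq_map_gramD L e dV hdV dW hdW) p).2
        fun w => (isSiegelDelta_locToAdelic_iff L e dV hdV dW hdW v p).1 hS w
    have h8 := localSplittingDatumCM_parabolic L v (𝔪 v).μ n (gramR_isSymm L e dV hdV dW hdW)
      (isUnit_det_gramR₀ L e dV hdV hdV0 dW hdW hdW0) (hermD_eq_map_gramD L e dV hdV dW hdW) χ hχ
      (deltaLoc L e dV hdV hdV0 dW hdW hdW0 v) (map_deltaLoc_deltaLagrangian L e dV hdV hdV0 dW hdW hdW0 v) p hp Φ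
    have hX := chiDet_inv (Fp L) L (IsCMField.complexConj L) v n
      (fun w' : UnitaryGroup.PlacesOver L v => χ.localComponent w'.1) p
    rw [hX, inv_inv] at h8
    rw [chiDet_locToAdelic_eq_prod_dite L e dV hdV dW hdW v χ p hloc, modDelta_locToAdelic L e dV hdV dW hdW v p hloc]
    exact h8
  · exact (eventually_isGoodPlace_localComponent_inv L n (isUnit_det_gramR₀ L e dV hdV hdV0 dW hdW hdW0) χ).mono
      fun v hgood => by
        letI := (𝔪 v).mS; haveI := (𝔪 v).isBorel; haveI := (𝔪 v).isHaar
        exact localSplittingDatumCM_unramified L v (𝔪 v).μ n (gramR_isSymm L e dV hdV dW hdW)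
          (isUnit_det_gramR₀ L e dV hdV hdV0 dW hdW hdW0) (hermD_eq_map_gramD L e dV hdV dW hdW) χ hχ hgood

end Family

end S1finLocal

end Literature.NumberTheory.GelbartRogawski1991.GRConstruction
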